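import Mathlib
import Summits.ResolutionOfSingularities.ResolutionOfSingularities.Theorems.WeightedInvariantLocalWeightedDropPolyDescentDissolveSegment

/-!
# `WeightedInvariant.LocalWeightedDrop`, stub S3ρ: the monic polyhedron descent — DISSOLVING ONE SOLVABLE VERTEX of the `d!`-scaled Newton set
# of a tuple (piece ρ-P `stub_polyPrep`, HALF A «dissolution step», part 2)

Crux item stmt-ResolutionOfSingularities-8899 `LocalWeightedDrop` (route `ResolutionOfSingularities/WeightedInvariant`), registered skeleton v30
(09f812eb3be8b7d8), stub S3ρ `stub_wildMonicSurfaceReductionWon`; line «monic polyhedron descent» (res-L1-w43-lead-1,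
`L/res-L1-w43-lead-1/g3/poly_descent_line_v1.lean` 905148e143a15d9b), named stub (ρ-P) `PolyDescent.stub_polyPrep` (lead res-type-061, CUT
2026-08-27T08:23:14Z: HALF A = `…PolyDescentDissolveSegment` + this file; HALF B = `…PolyDescentPrepSeq` / `…PolyDescentPrepExists` imports this
file).  [OURS · L1 W4.3, chain w43, stub worker 2 (gen 3) as (ρ-P) second hand; MODEL: Hironaka's vertex preparation, Cossart–Jannsen–Saito LNM 2270
Ch. 8 ("dissolving a solvable vertex"), for `J = (y^d + Σ_{j<d} A_j y^j)`; TEMPLATE: lead-1's degree-2 `…MonicDescentDissolve` (`coeff_dissolveFst_self`,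
`weight_dissolve_gt`, `uniqueMin_dissolve`); nothing here is a statement of any manuscript.]

With `P_v = d!·v` the scaled centre of the re-centring `y ↦ y + c·u^v` (`WildMonic.shift d A (monomial v c)`):
* (A3) `coeff_shift_monomial_vertexExp`, `shift_const_eq`, `coeff_shift_monomial_vertexExp_eq_shift` — AT THE CENTRE the vertex polynomial is
  Taylor-shifted: `[u^{(d−j)v}](shift d A (c u^v))_j = shift d (vertexCoeff d A P_v ·) c j`, i.e. `F_{P_v}(Y) ↦ F_{P_v}(Y + c)`;
* (A4) `coeff_shift_monomial_vertexExp_eq_zero`, `vertexCoeff_dissolve_eq_zero`, `not_mem_newtonSet_dissolve` — if `P_v` is SOLVABLE with root `λ`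
  (`F = (Y+λ)^d`) then `c = −λ` DISSOLVES it: `P_v ∉ newtonSet (shift d A (−λ u^v))` (`(Y + λ − λ)^d = Y^d`, by `WildMonic.shift_shift`);
* (A6) `lt_weight_of_mem_newtonSet_dissolve` — after dissolving a unique `w`-minimal `P_v` everything is strictly `w`-above `P_v`;
* (A7) `lt_weight_of_mem_newtonSet_shift_monomial_of_ne`, `vertexCoeff_shift_monomial_of_ne`, `mem_newtonSet_shift_monomial_of_ne`,
  `isVertex_shift_monomial_of_ne`, `solvable_shift_monomial_iff_of_ne` — every OTHER unique-minimum vertex `P′` persists WITH ITS VERTEX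
  COEFFICIENTS (hence with its (non-)solvability);
* (A8) `two_le_degree_of_mem_newtonSet`, `isPosT_shift_monomial` — positions stay positions (`|v| ≥ 2` because `|P_v| > d!`).
-/

set_option linter.dupNamespace false -- mandated namespace of this single-conjunct summit

noncomputable section

namespace Summit.ResolutionOfSingularities.ResolutionOfSingularities.Theorems

namespace PolyDescent

open MvPowerSeries MonicDescent WildMonic Literature.RingTheory.TwoVariableSeries

variable {k : Type} [Field k]

/-! ## (A3) At the centre: the vertex polynomial is Taylor-shifted -/

/-- **THE COEFFICIENTS AT THE CENTRE**: `[u^{(d−j)·v}](shift d A (c u^v))_j = C(d,j)·c^{d−j} + Σ_{i ≥ j} C(i,j)·c^{i−j}·vertexCoeff_i(P_v)`. -/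
theorem coeff_shift_monomial_vertexExp {d : ℕ} (A : Fin d → MvPowerSeries (Fin 2) k) (v : Fin 2 →₀ ℕ) (c : k) (j : Fin d) :
    coeff ((d - (j : ℕ)) • v) (shift d A (monomial v c) j) =
      ((d.choose j : ℕ) : k) * c ^ (d - (j : ℕ)) +
        ∑ i : Fin d, if (j : ℕ) ≤ i then (((i : ℕ).choose j : ℕ) : k) * c ^ ((i : ℕ) - j) * vertexCoeff d A (d.factorial • v) i
          else 0 := by
  classical
  rw [coeff_shift_monomial, if_pos rfl]
  congr 1
  refine Finset.sum_congr rfl fun i _ => ?_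
  by_cases hji : (j : ℕ) ≤ i
  · have hi := i.2
    have hle : ((i : ℕ) - j) • v ≤ (d - (j : ℕ)) • v := fun l => by
      rw [Finsupp.smul_apply, Finsupp.smul_apply, smul_eq_mul, smul_eq_mul]
      exact Nat.mul_le_mul_right _ (by omega)
    rw [if_pos hle, if_pos hji, vertexCoeff_factorial_smul, smul_tsub_smul,
      show d - (j : ℕ) - ((i : ℕ) - j) = d - (i : ℕ) by omega]
  · rw [if_neg hji, Nat.choose_eq_zero_of_lt (not_le.mp hji), Nat.cast_zero, zero_mul, zero_mul, ite_self]

/-- The Taylor shift of a CONSTANT tuple `I : Fin d → k` in the same shape: `shift d I c j = C(d,j)·c^{d−j} + Σ_{i ≥ j} C(i,j)·c^{i−j}·I_i`. -/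
theorem shift_const_eq {d : ℕ} (I : Fin d → k) (c : k) (j : Fin d) :
    shift d I c j = ((d.choose j : ℕ) : k) * c ^ (d - (j : ℕ)) +
      ∑ i : Fin d, if (j : ℕ) ≤ i then (((i : ℕ).choose j : ℕ) : k) * c ^ ((i : ℕ) - j) * I i else 0 := by
  rw [shift_eq]
  congr 1
  refine Finset.sum_congr rfl fun i _ => ?_
  by_cases hji : (j : ℕ) ≤ i
  · rw [if_pos hji]; ring
  · rw [if_neg hji, Nat.choose_eq_zero_of_lt (not_le.mp hji), Nat.cast_zero, zero_mul, zero_mul]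

/-- **THE VERTEX POLYNOMIAL IS TAYLOR-SHIFTED**: `[u^{(d−j)·v}](shift d A (c u^v))_j = shift d (vertexCoeff d A P_v ·) c j` — the vertex polynomial
`F_{P_v}(Y) = Y^d + Σ_i vertexCoeff_i Y^i` of the centre becomes `F_{P_v}(Y + c)`. -/
theorem coeff_shift_monomial_vertexExp_eq_shift {d : ℕ} (A : Fin d → MvPowerSeries (Fin 2) k) (v : Fin 2 →₀ ℕ) (c : k) (j : Fin d) :
    coeff ((d - (j : ℕ)) • v) (shift d A (monomial v c) j) = shift d (fun i => vertexCoeff d A (d.factorial • v) i) c j := by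
  rw [coeff_shift_monomial_vertexExp, shift_const_eq]

/-! ## (A4) Dissolving a solvable vertex -/

/-- If the vertex polynomial at `P_v` is `(Y + λ)^d` then after `y ↦ y − λ·u^v` every slot vanishes at the centre exponent
(`(Y + λ − λ)^d = Y^d`). -/
theorem coeff_shift_monomial_vertexExp_eq_zero {d : ℕ} (A : Fin d → MvPowerSeries (Fin 2) k) (v : Fin 2 →₀ ℕ) (la : k)
    (hsol : ∀ i : Fin d, vertexCoeff d A (d.factorial • v) i = ((d.choose i : ℕ) : k) * la ^ (d - (i : ℕ))) (j : Fin d) :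
    coeff ((d - (j : ℕ)) • v) (shift d A (monomial v (-la)) j) = 0 := by
  rw [coeff_shift_monomial_vertexExp_eq_shift]
  have hI : (fun i => vertexCoeff d A (d.factorial • v) i) = shift d (fun _ : Fin d => (0 : k)) la := by
    funext i; rw [hsol i, shift_zero_tuple]
  rw [hI, WildMonic.shift_shift, neg_add_cancel, WildMonic.shift_zero]

/-- … so every vertex coefficient of the re-centred tuple at `P_v` vanishes. -/
theorem vertexCoeff_dissolve_eq_zero {d : ℕ} (A : Fin d → MvPowerSeries (Fin 2) k) (v : Fin 2 →₀ ℕ) (la : k)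
    (hsol : ∀ i : Fin d, vertexCoeff d A (d.factorial • v) i = ((d.choose i : ℕ) : k) * la ^ (d - (i : ℕ))) (j : Fin d) :
    vertexCoeff d (shift d A (monomial v (-la))) (d.factorial • v) j = 0 := by
  rw [vertexCoeff_factorial_smul, coeff_shift_monomial_vertexExp_eq_zero A v la hsol]

/-- **THE CENTRE IS DISSOLVED**: `P_v ∉ newtonSet (shift d A (−λ u^v))`. -/
theorem not_mem_newtonSet_dissolve {d : ℕ} (A : Fin d → MvPowerSeries (Fin 2) k) (v : Fin 2 →₀ ℕ) (la : k)
    (hsol : ∀ i : Fin d, vertexCoeff d A (d.factorial • v) i = ((d.choose i : ℕ) : k) * la ^ (d - (i : ℕ))) :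
    d.factorial • v ∉ newtonSet (shift d A (monomial v (-la))) := by
  intro hmem
  obtain ⟨j, hj⟩ := exists_vertexCoeff_ne_zero_of_mem hmem
  exact hj (vertexCoeff_dissolve_eq_zero A v la hsol j)

/-! ## (A6) After dissolving, everything is strictly above the centre -/

/-- the segment identity under a weight, with the centre strictly below the old point: the new point is strictly above the centre. -/
private theorem seg_lt {d i j : ℕ} (hi : i < d) (hji : j ≤ i) {wQ wP wC : ℕ} (h : (d - j) * wQ = (d - i) * wP + (i - j) * wC)
    (hP : wC < wP) : wC < wQ := by
  have h2 : (d - j) * wC < (d - j) * wQ := by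
    rw [h]
    calc (d - j) * wC = (d - i) * wC + (i - j) * wC := by rw [← add_mul]; congr 1; omega
      _ < (d - i) * wP + (i - j) * wC := by
          have : (d - i) * wC < (d - i) * wP := Nat.mul_lt_mul_of_pos_left hP (by omega)
          omega
  exact Nat.lt_of_mul_lt_mul_left h2

/-- **AFTER DISSOLVING A UNIQUE `w`-MINIMUM, EVERYTHING IS STRICTLY `w`-ABOVE IT** (the dissolved vertex never comes back). -/
theorem lt_weight_of_mem_newtonSet_dissolve {d : ℕ} (A : Fin d → MvPowerSeries (Fin 2) k) (v : Fin 2 →₀ ℕ) (la : k)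
    (hsol : ∀ i : Fin d, vertexCoeff d A (d.factorial • v) i = ((d.choose i : ℕ) : k) * la ^ (d - (i : ℕ))) (w : Fin 2 → ℕ)
    (hmin : ∀ Q ∈ newtonSet A, Q ≠ d.factorial • v → Finsupp.weight w (d.factorial • v) < Finsupp.weight w Q)
    {Q : Fin 2 →₀ ℕ} (hQ : Q ∈ newtonSet (shift d A (monomial v (-la)))) :
    Finsupp.weight w (d.factorial • v) < Finsupp.weight w Q := by
  have hQv : Q ≠ d.factorial • v := fun h => not_mem_newtonSet_dissolve A v la hsol (h ▸ hQ)
  rcases mem_newtonSet_shift_monomial A v (-la) hQ with h | ⟨i, j, P, hji, hP, hseg⟩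
  · exact absurd h hQv
  · have hi := i.2
    by_cases hPv : P = d.factorial • v
    · -- then `Q = P_v`, excluded
      exfalso
      apply hQv
      rw [hPv, ← add_smul, show d - (i : ℕ) + ((i : ℕ) - j) = d - (j : ℕ) by omega] at hseg
      have h0 := congrArg (fun f : Fin 2 →₀ ℕ => f 0) hseg
      have h1 := congrArg (fun f : Fin 2 →₀ ℕ => f 1) hseg
      simp only [Finsupp.smul_apply, smul_eq_mul] at h0 h1
      have hdj : 0 < d - (j : ℕ) := by omega
      exact finsupp_fin2_ext (Nat.eq_of_mul_eq_mul_left hdj h0) (Nat.eq_of_mul_eq_mul_left hdj h1)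
    · have h1 := congrArg (Finsupp.weight w) hseg
      rw [map_nsmul, map_add, map_nsmul, map_nsmul, smul_eq_mul, smul_eq_mul, smul_eq_mul] at h1
      exact seg_lt hi hji h1 (hmin P hP hPv)

/-! ## (A7) Every other unique-minimum vertex persists with its vertex coefficients -/

section OtherVertex

variable {d : ℕ} (A : Fin d → MvPowerSeries (Fin 2) k) (v : Fin 2 →₀ ℕ) (c : k) (w : Fin 2 → ℕ) {P' : Fin 2 →₀ ℕ}
  (hP'v : P' ≠ d.factorial • v) (hv : d.factorial • v ∈ newtonSet A)
  (hmin : ∀ Q ∈ newtonSet A, Q ≠ P' → Finsupp.weight w P' < Finsupp.weight w Q)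
include hP'v hv hmin

/-- the segment identity under `w` with an old point `P` and the centre, both `w`-above `P′` (one strictly): strict. -/
private theorem seg_lt' {i j : ℕ} (hi : i < d) (hji : j ≤ i) {wQ wP : ℕ}
    (h : (d - j) * wQ = (d - i) * wP + (i - j) * Finsupp.weight w (d.factorial • v)) (hP : Finsupp.weight w P' ≤ wP)
    (hstrict : Finsupp.weight w P' < wP ∨ j < i) : Finsupp.weight w P' < wQ := by
  have hC : Finsupp.weight w P' < Finsupp.weight w (d.factorial • v) := hmin _ hv hP'v.symm
  have h2 : (d - j) * Finsupp.weight w P' < (d - j) * wQ := by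
    rw [h]
    rcases hstrict with hlt | hlt
    · calc (d - j) * Finsupp.weight w P' = (d - i) * Finsupp.weight w P' + (i - j) * Finsupp.weight w P' := by
            rw [← add_mul]; congr 1; omega
        _ < (d - i) * wP + (i - j) * Finsupp.weight w (d.factorial • v) := by
            have h3 : (d - i) * Finsupp.weight w P' < (d - i) * wP := Nat.mul_lt_mul_of_pos_left hlt (by omega)
            have h4 : (i - j) * Finsupp.weight w P' ≤ (i - j) * Finsupp.weight w (d.factorial • v) := Nat.mul_le_mul_left _ hC.le
            omega
    · calc (d - j) * Finsupp.weight w P' = (d - i) * Finsupp.weight w P' + (i - j) * Finsupp.weight w P' := by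
            rw [← add_mul]; congr 1; omega
        _ < (d - i) * wP + (i - j) * Finsupp.weight w (d.factorial • v) := by
            have h3 : (d - i) * Finsupp.weight w P' ≤ (d - i) * wP := Nat.mul_le_mul_left _ hP
            have h4 : (i - j) * Finsupp.weight w P' < (i - j) * Finsupp.weight w (d.factorial • v) :=
              Nat.mul_lt_mul_of_pos_left hC (by omega)
            omega
  exact Nat.lt_of_mul_lt_mul_left h2

/-- **A UNIQUE `w`-MINIMUM `P′ ≠ P_v` STAYS STRICTLY `w`-BELOW every other point of the re-centred Newton set.** -/
theorem lt_weight_of_mem_newtonSet_shift_monomial_of_ne {Q : Fin 2 →₀ ℕ} (hQ : Q ∈ newtonSet (shift d A (monomial v c)))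
    (hQ' : Q ≠ P') : Finsupp.weight w P' < Finsupp.weight w Q := by
  rcases mem_newtonSet_shift_monomial A v c hQ with rfl | ⟨i, j, P, hji, hP, hseg⟩
  · exact hmin _ hv hP'v.symm
  · have hi := i.2
    have h1 := congrArg (Finsupp.weight w) hseg
    rw [map_nsmul, map_add, map_nsmul, map_nsmul, smul_eq_mul, smul_eq_mul, smul_eq_mul] at h1
    by_cases hPP : P = P'
    · subst hPP
      refine seg_lt' A v w hP'v hv hmin hi hji h1 le_rfl (Or.inr (lt_of_le_of_ne hji fun hij => hQ' ?_))
      -- `i = j`: then `Q = P′`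
      rw [← hij, Nat.sub_self, zero_smul, add_zero] at hseg
      have h0 := congrArg (fun f : Fin 2 →₀ ℕ => f 0) hseg
      have h1' := congrArg (fun f : Fin 2 →₀ ℕ => f 1) hseg
      simp only [Finsupp.smul_apply, smul_eq_mul] at h0 h1'
      have hdj : 0 < d - (j : ℕ) := by omega
      exact finsupp_fin2_ext (Nat.eq_of_mul_eq_mul_left hdj h0) (Nat.eq_of_mul_eq_mul_left hdj h1')
    · exact seg_lt' A v w hP'v hv hmin hi hji h1 (hmin P hP hPP).le (Or.inl (hmin P hP hPP))

/-- **THE VERTEX COEFFICIENTS OF `P′` ARE UNTOUCHED**: a contribution from a higher slot would put `P′` strictly inside a segment from an old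
point to the centre, contradicting its minimality. -/
theorem vertexCoeff_shift_monomial_of_ne (j : Fin d) : vertexCoeff d (shift d A (monomial v c)) P' j = vertexCoeff d A P' j := by
  classical
  by_cases hdvd : ∀ l, slotWeight d j ∣ P' l
  · rw [vertexCoeff_of_dvd _ hdvd, vertexCoeff_of_dvd _ hdvd]
    set e : Fin 2 →₀ ℕ := Finsupp.single 0 (P' 0 / slotWeight d j) + Finsupp.single 1 (P' 1 / slotWeight d j) with he
    have hPe : P' = slotWeight d j • e := by
      refine finsupp_fin2_ext ?_ ?_
      · simp [he, Nat.mul_div_cancel' (hdvd 0)]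
      · simp [he, Nat.mul_div_cancel' (hdvd 1)]
    have hj := j.2
    rw [coeff_shift_monomial]
    have hfirst : ¬ e = (d - (j : ℕ)) • v := by
      intro h; apply hP'v; rw [hPe, h, ← factorial_smul_eq_slotWeight_smul]
    rw [if_neg hfirst, zero_add, Finset.sum_eq_single j]
    · rw [Nat.sub_self, zero_smul, if_pos (show (0 : Fin 2 →₀ ℕ) ≤ _ from fun l => Nat.zero_le _), Nat.choose_self, Nat.cast_one, pow_zero, one_mul, one_mul, tsub_zero]
    · intro i _ hij
      by_cases hlt : (i : ℕ) < j
      · rw [Nat.choose_eq_zero_of_lt hlt, Nat.cast_zero, zero_mul, zero_mul, ite_self]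
      · have hgt : (j : ℕ) < i := lt_of_le_of_ne (not_lt.mp hlt) (fun h => hij (Fin.ext h).symm)
        have hi := i.2
        split_ifs with hle
        · -- a non-zero `A_i`-coefficient here would contradict the minimality of `P′`
          by_contra hterm
          have hcoef : coeff (e - ((i : ℕ) - j) • v) (A i) ≠ 0 := by
            intro h0; apply hterm; rw [h0, mul_zero]
          set P'' : Fin 2 →₀ ℕ := slotWeight d i • (e - ((i : ℕ) - j) • v) with hP''
          have hP''mem : P'' ∈ newtonSet A := ⟨i, _, hcoef, rfl⟩
          -- the segment identity `(d−j)·P′ = (d−i)·P″ + (i−j)·P_v`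
          have hseg : (d - (j : ℕ)) • P' = (d - (i : ℕ)) • P'' + ((i : ℕ) - j) • (d.factorial • v) := by
            have he' : e = (e - ((i : ℕ) - j) • v) + ((i : ℕ) - j) • v := (tsub_add_cancel_of_le hle).symm
            rw [hPe, hP'', smul_smul, smul_smul, smul_smul, mul_comm (d - (j : ℕ)), slotWeight_mul_sub j, mul_comm (d - (i : ℕ)),
              slotWeight_mul_sub i]
            conv_lhs => rw [he']
            rw [smul_add, smul_smul, mul_comm]
          clear_value P''
          have h1 : (d - (j : ℕ)) * Finsupp.weight w P' =
              (d - (i : ℕ)) * Finsupp.weight w P'' + ((i : ℕ) - j) * Finsupp.weight w (d.factorial • v) := by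
            have h := congrArg (Finsupp.weight w) hseg
            simp only [map_add] at h
            rw [map_nsmul, map_nsmul, map_nsmul, smul_eq_mul, smul_eq_mul, smul_eq_mul] at h
            exact h
          by_cases hPP : P'' = P'
          · have h := seg_lt' A v w hP'v hv hmin hi hgt.le h1 (by rw [hPP]) (Or.inr hgt)
            exact lt_irrefl _ h
          · have h := seg_lt' A v w hP'v hv hmin hi hgt.le h1 (hmin P'' hP''mem hPP).le (Or.inl (hmin P'' hP''mem hPP))
            exact lt_irrefl _ h
        · rfl
    · intro h; exact absurd (Finset.mem_univ j) h
  · rw [vertexCoeff_of_not_dvd _ hdvd, vertexCoeff_of_not_dvd _ hdvd]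

/-- **`P′` STAYS IN THE NEWTON SET.** -/
theorem mem_newtonSet_shift_monomial_of_ne (hP' : P' ∈ newtonSet A) : P' ∈ newtonSet (shift d A (monomial v c)) := by
  obtain ⟨j, hj⟩ := exists_vertexCoeff_ne_zero_of_mem hP'
  rw [← vertexCoeff_shift_monomial_of_ne A v c w hP'v hv hmin j] at hj
  exact mem_newtonSet_of_vertexCoeff_ne_zero hj

/-- **`P′` STAYS A VERTEX** (for the same weight). -/
theorem isVertex_shift_monomial_of_ne (hw : ∀ i, 0 < w i) (hP' : P' ∈ newtonSet A) : IsVertex (newtonSet (shift d A (monomial v c))) P' :=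
  ⟨mem_newtonSet_shift_monomial_of_ne A v c w hP'v hv hmin hP', w, hw,
    fun _ hQ hQ' => lt_weight_of_mem_newtonSet_shift_monomial_of_ne A v c w hP'v hv hmin hQ hQ'⟩

/-- **`P′` KEEPS ITS (NON-)SOLVABILITY.** -/
theorem solvable_shift_monomial_iff_of_ne : Solvable d (shift d A (monomial v c)) P' ↔ Solvable d A P' := by
  unfold Solvable
  simp only [vertexCoeff_shift_monomial_of_ne A v c w hP'v hv hmin]

end OtherVertex

/-! ## (A8) Positions stay positions -/

/-- For a position, a centre point `P_v = d!·v` of the scaled Newton set has `|v| ≥ 2` (since `|P_v| > d!`). -/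
theorem two_le_degree_of_mem_newtonSet {d : ℕ} {A : Fin d → MvPowerSeries (Fin 2) k} (hA : IsPosT d A) {v : Fin 2 →₀ ℕ}
    (hv : d.factorial • v ∈ newtonSet A) : 2 ≤ v 0 + v 1 := by
  have hlt := factorial_lt_sum_of_isPosT hA _ hv
  simp only [Finsupp.smul_apply, smul_eq_mul] at hlt
  by_contra h
  push Not at h
  have : d.factorial * (v 0 + v 1) ≤ d.factorial * 1 := Nat.mul_le_mul_left _ (by omega)
  rw [Nat.mul_add, mul_one] at this
  omega

/-- **POSITIONS STAY POSITIONS** under `y ↦ y + c·u^v` with `|v| ≥ 2`: `ord (shift d A (c u^v))_j > d − j`. -/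
theorem isPosT_shift_monomial {d : ℕ} {A : Fin d → MvPowerSeries (Fin 2) k} (hA : IsPosT d A) {v : Fin 2 →₀ ℕ} (hv2 : 2 ≤ v 0 + v 1)
    (c : k) : IsPosT d (shift d A (monomial v c)) := by
  classical
  intro j
  have hj := j.2
  -- every coefficient of degree `≤ d − j` vanishes
  have hzero : ∀ f : Fin 2 →₀ ℕ, f 0 + f 1 ≤ d - (j : ℕ) → coeff f (shift d A (monomial v c) j) = 0 := by
    intro f hf
    rw [coeff_shift_monomial]
    have hfirst : ¬ f = (d - (j : ℕ)) • v := by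
      intro h
      rw [h] at hf
      simp only [Finsupp.smul_apply, smul_eq_mul] at hf
      have : (d - (j : ℕ)) * 2 ≤ (d - (j : ℕ)) * (v 0 + v 1) := Nat.mul_le_mul_left _ hv2
      rw [Nat.mul_add] at this
      omega
    rw [if_neg hfirst, zero_add]
    refine Finset.sum_eq_zero fun i _ => ?_
    by_cases hlt : (i : ℕ) < j
    · rw [Nat.choose_eq_zero_of_lt hlt, Nat.cast_zero, zero_mul, zero_mul, ite_self]
    · have hji : (j : ℕ) ≤ i := not_lt.mp hlt
      have hi := i.2
      split_ifs with hle
      · by_cases h0 : coeff (f - ((i : ℕ) - j) • v) (A i) = 0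
        · rw [h0, mul_zero]
        · exfalso
          have hlt' := sub_lt_sum_of_isPosT hA i h0
          rw [Finsupp.tsub_apply, Finsupp.tsub_apply, Finsupp.smul_apply, Finsupp.smul_apply, smul_eq_mul, smul_eq_mul] at hlt'
          have hle0 := hle 0; have hle1 := hle 1
          rw [Finsupp.smul_apply, smul_eq_mul] at hle0 hle1
          have : ((i : ℕ) - j) * 2 ≤ ((i : ℕ) - j) * (v 0 + v 1) := Nat.mul_le_mul_left _ hv2
          rw [Nat.mul_add] at this
          omega
      · rfl
  -- hence the order exceeds `d − j`
  have hle : ((d - (j : ℕ) + 1 : ℕ) : ℕ∞) ≤ (shift d A (monomial v c) j).order := by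
    refine MvPowerSeries.nat_le_order fun f hf => hzero f ?_
    have hdeg : Finsupp.degree f = f 0 + f 1 := by rw [Finsupp.degree_eq_sum]; simp [Fin.sum_univ_two]
    rw [hdeg] at hf
    omega
  exact lt_of_lt_of_le (Nat.cast_lt.mpr (Nat.lt_succ_self _)) hle

end PolyDescent

end Summit.ResolutionOfSingularities.ResolutionOfSingularities.Theorems

end
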